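import Summits.ValiantsHypothesis.ValiantsHypothesis.Theorems.LiftNullstellensatzLiftWidthPerFourTensorTrain

/-!
# Route LiftNullstellensatz — `LiftWidthPerFour` (item stmt-ValiantsHypothesis-5922): flattening
ranks of a tensor train (converse of Nisan's normal form)

If `Ψ(w) = Σ_{k,s,t} L₁(w₀)_k L₂(w₁)_{ks} L₃(w₂)_{st} L₄(w₃)_t` is a tensor train of bond dimensions
`(a, b, c)`, then its sequential flattenings (route coordinates, cuts `1|3, 2|2, 3|1`) have ranks
`≤ a, ≤ b, ≤ c` (`rank_flattening_le_of_tt₁/₂/₃`): each flattening is a product through `Fin a`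
(resp. `Fin b`, `Fin c`).  Together with `exists_abp_of_rank_le` this is Nisan's characterisation
of homogeneous ABP width by flattening ranks; it is the direction needed to turn an explicit ABP of
format `(5,5,5)` for `per_4` — should one exist — into a refutation of `LiftWidthPerFour`.
-/

noncomputable section

namespace Summit.ValiantsHypothesis.LiftNullstellensatz

variable {F : Type*} [Field F] {σ : Type*} [Fintype σ] {a b c : ℕ}

/-- Cut `1 | 3` of a tensor train of bond dimensions `(a,b,c)` has rank `≤ a`.
[cite: Nisan1991, Lemma 1 (method)] -/
theorem rank_flattening_le_of_tt₁ (Ψ : (Fin 4 → σ) → F) (L₁ : σ → Fin a → F)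
    (L₂ : σ → Fin a → Fin b → F) (L₃ : σ → Fin b → Fin c → F) (L₄ : σ → Fin c → F)
    (hΨ : ∀ w : Fin 4 → σ,
      Ψ w = ∑ k, ∑ s, ∑ t, L₁ (w 0) k * L₂ (w 1) k s * L₃ (w 2) s t * L₄ (w 3) t)
    (h : 1 + 3 = 4) :
    (Matrix.of fun (u : Fin 1 → σ) (v : Fin 3 → σ) =>
      Ψ (fun t => Fin.append u v (Fin.cast h.symm t))).rank ≤ a := by
  classical
  have key : (Matrix.of fun (u : Fin 1 → σ) (v : Fin 3 → σ) =>
      Ψ (fun t => Fin.append u v (Fin.cast h.symm t))) =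
      (Matrix.of fun (u : Fin 1 → σ) (k : Fin a) => L₁ (u 0) k) *
      (Matrix.of fun (k : Fin a) (v : Fin 3 → σ) =>
        ∑ s, ∑ t, L₂ (v 0) k s * L₃ (v 1) s t * L₄ (v 2) t) := by
    ext u v
    have hw : (fun t : Fin 4 => Fin.append u v (Fin.cast h.symm t)) = ![u 0, v 0, v 1, v 2] := by
      funext t; fin_cases t <;> rfl
    rw [Matrix.of_apply, hw, hΨ, Matrix.mul_apply]
    refine Finset.sum_congr rfl fun k _ => ?_
    rw [Matrix.of_apply, Matrix.of_apply, Finset.mul_sum]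
    refine Finset.sum_congr rfl fun s _ => ?_
    rw [Finset.mul_sum]
    refine Finset.sum_congr rfl fun t _ => ?_
    simp only [Matrix.cons_val_zero, Matrix.cons_val_one, Matrix.cons_val]
    ring
  rw [key]
  exact (Matrix.rank_mul_le_left _ _).trans
    ((Matrix.rank_le_card_width _).trans (by rw [Fintype.card_fin]))

/-- Cut `2 | 2` of a tensor train of bond dimensions `(a,b,c)` has rank `≤ b`.
[cite: Nisan1991, Lemma 1 (method)] -/
theorem rank_flattening_le_of_tt₂ (Ψ : (Fin 4 → σ) → F) (L₁ : σ → Fin a → F)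
    (L₂ : σ → Fin a → Fin b → F) (L₃ : σ → Fin b → Fin c → F) (L₄ : σ → Fin c → F)
    (hΨ : ∀ w : Fin 4 → σ,
      Ψ w = ∑ k, ∑ s, ∑ t, L₁ (w 0) k * L₂ (w 1) k s * L₃ (w 2) s t * L₄ (w 3) t)
    (h : 2 + 2 = 4) :
    (Matrix.of fun (u : Fin 2 → σ) (v : Fin 2 → σ) =>
      Ψ (fun t => Fin.append u v (Fin.cast h.symm t))).rank ≤ b := by
  classical
  have key : (Matrix.of fun (u : Fin 2 → σ) (v : Fin 2 → σ) =>
      Ψ (fun t => Fin.append u v (Fin.cast h.symm t))) =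
      (Matrix.of fun (u : Fin 2 → σ) (s : Fin b) => ∑ k, L₁ (u 0) k * L₂ (u 1) k s) *
      (Matrix.of fun (s : Fin b) (v : Fin 2 → σ) => ∑ t, L₃ (v 0) s t * L₄ (v 1) t) := by
    ext u v
    have hw : (fun t : Fin 4 => Fin.append u v (Fin.cast h.symm t)) = ![u 0, u 1, v 0, v 1] := by
      funext t; fin_cases t <;> rfl
    rw [Matrix.of_apply, hw, hΨ, Matrix.mul_apply]
    -- Σ_k Σ_s Σ_t  =  Σ_s (Σ_k ..) * (Σ_t ..)
    rw [Finset.sum_comm]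
    refine Finset.sum_congr rfl fun s _ => ?_
    rw [Matrix.of_apply, Matrix.of_apply, Finset.sum_mul_sum]
    refine Finset.sum_congr rfl fun k _ => Finset.sum_congr rfl fun t _ => ?_
    simp only [Matrix.cons_val_zero, Matrix.cons_val_one, Matrix.cons_val]
    ring
  rw [key]
  exact (Matrix.rank_mul_le_left _ _).trans
    ((Matrix.rank_le_card_width _).trans (by rw [Fintype.card_fin]))

/-- Cut `3 | 1` of a tensor train of bond dimensions `(a,b,c)` has rank `≤ c`.
[cite: Nisan1991, Lemma 1 (method)] -/
theorem rank_flattening_le_of_tt₃ (Ψ : (Fin 4 → σ) → F) (L₁ : σ → Fin a → F)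
    (L₂ : σ → Fin a → Fin b → F) (L₃ : σ → Fin b → Fin c → F) (L₄ : σ → Fin c → F)
    (hΨ : ∀ w : Fin 4 → σ,
      Ψ w = ∑ k, ∑ s, ∑ t, L₁ (w 0) k * L₂ (w 1) k s * L₃ (w 2) s t * L₄ (w 3) t)
    (h : 3 + 1 = 4) :
    (Matrix.of fun (u : Fin 3 → σ) (v : Fin 1 → σ) =>
      Ψ (fun t => Fin.append u v (Fin.cast h.symm t))).rank ≤ c := by
  classical
  have key : (Matrix.of fun (u : Fin 3 → σ) (v : Fin 1 → σ) =>
      Ψ (fun t => Fin.append u v (Fin.cast h.symm t))) =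
      (Matrix.of fun (u : Fin 3 → σ) (t : Fin c) =>
        ∑ k, ∑ s, L₁ (u 0) k * L₂ (u 1) k s * L₃ (u 2) s t) *
      (Matrix.of fun (t : Fin c) (v : Fin 1 → σ) => L₄ (v 0) t) := by
    ext u v
    have hw : (fun t : Fin 4 => Fin.append u v (Fin.cast h.symm t)) = ![u 0, u 1, u 2, v 0] := by
      funext t; fin_cases t <;> rfl
    rw [Matrix.of_apply, hw, hΨ, Matrix.mul_apply]
    simp only [Matrix.cons_val_zero, Matrix.cons_val_one, Matrix.cons_val, Matrix.of_apply,
      Finset.sum_mul]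
    -- Σ_k Σ_s Σ_t = Σ_t Σ_k Σ_s
    calc (∑ k : Fin a, ∑ s : Fin b, ∑ t : Fin c,
            L₁ (u 0) k * L₂ (u 1) k s * L₃ (u 2) s t * L₄ (v 0) t)
        = ∑ k : Fin a, ∑ t : Fin c, ∑ s : Fin b,
            L₁ (u 0) k * L₂ (u 1) k s * L₃ (u 2) s t * L₄ (v 0) t :=
          Finset.sum_congr rfl fun k _ => Finset.sum_comm
      _ = ∑ t : Fin c, ∑ k : Fin a, ∑ s : Fin b,
            L₁ (u 0) k * L₂ (u 1) k s * L₃ (u 2) s t * L₄ (v 0) t := Finset.sum_comm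
  rw [key]
  exact (Matrix.rank_mul_le_left _ _).trans
    ((Matrix.rank_le_card_width _).trans (by rw [Fintype.card_fin]))

end Summit.ValiantsHypothesis.LiftNullstellensatz

end
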